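import Summits.QuantumFields.BalabanUV.Beta.D1BFx.ProfileWordCount

/-!
# `BalabanUV.Beta.D1BFx.ProfileWordFamiliesCrit` — road «BF-x» for binder row D1, slot (K): THE PROFILE WORD-FAMILY LETTER (d1), PART 3 — **THE CRITICAL
# TWIN `a + b = D`**: `Decay510 (z ↦ biBubble L₁ (𝒱 μ 0) L₂ (𝒱′ ν z)) (|F|²·(Kᵣ(a)κ₁A)·(Kᵣ(b)κ₂A′)·K^crit_D(ε)·n^D·(3 + 8∕ε + log n)) (ε∕(2D))` — the MAIN word's
# `log n` envelope (two bare Coulomb legs between two density vertices), with NO coefficient claimed.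

WHY (GHOST-N8-SPEC v0 §2 (d1-b); OWNER d1-p2 g23 W-g23-12 l.49928 GO; «typed for completeness — it is R-1's log with a constant, no coefficient»): at
`D = 4`, `a = b = 2` (β2's bare ghost legs, `κ = C·n⁻²` each) and densities `A = A′ ≍ n⁻⁴`: `n⁻⁸·n⁻⁴·n⁴·(c + log n) = n⁻⁸(c + log n)` — the shape of the
main word `B_G_G` whose (1.22) moment grows like `−(1∕48π²)·log n` numerically (R-1 l.48286; N2 §1: `main` carries B∕B_univ = 0.996 ± 0.009 of the universal log).
The sub-critical rests are PART 2 `ProfileWordFamilies`; this file only adds the damping-centre-free CRITICAL one-centre sum the kit lacked, the critical double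
count, and the critical bubble family.  gaps-g1-p1 GEN 5's `Gaps/BlockPairCriticalOffBlock` (INTENT-12) refines the block-indexed critical count off the diagonal
block (no log there); the density form here keeps the log for every pair (it does not split the near class) — enough for an ENVELOPE.

CONTENT (all [folklore]; `‖·‖∞ = PoissonInterior.supNorm`, `nrm = max(1, ‖·‖∞)`, `|·|₁ = B12Sec2to5.l1`; `D ≥ 1`, `n ≥ 1`):
* §1 **`sum_exp_div_nrm_pow_crit_free_le`**: `Σ_{x∈S} e^{−(δ∕n)‖x−v‖∞}∕nrm(x−u)^D ≤ 2·(1 + 2D·3^{D−1}·(2 + 2∕δ + log n))` for ALL centres `u, v` (split at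
  `‖x−u‖∞ ≤ ‖x−v‖∞`; `LatticeHLSRadial.sum_exp_div_nrm_pow_crit_le` at each centre — the critical twin of `LatticeHLSProfiles.sum_exp_div_nrm_pow_free_le`).
* §2 **`sum_sum_damped_riesz_crit_le`** (`p = D`): `Σ_{x∈S}Σ_{z∈T} nrm(x−z)^{−D}·e^{−(ε∕n)‖x−z‖}·e^{−(ε∕n)‖z−C‖}·e^{−(ε∕n)‖x−C′‖} ≤ K^crit·n^D·(2 + 4∕ε + log n)·e^{−(ε∕2n)‖C−C′‖∞}`,
  `K^crit = 2·(1 + 2D·3^{D−1})·(1 + 2D·3^{D−1}·((D−1)!·(4∕ε)^{D−1}·(1+4∕ε)))` (using `2 + 4∕ε + log n ≥ 1` to absorb the kit's additive `1`).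
* §3 **`abs_biBubble_le_of_profiles_crit`** (explicit centres) and **`decay510_biBubble_of_profiles_crit`** (`a + b = D`; rate `ε∕(2D)`, `ε = min σ (2δ)`).

HONEST DEPENDENCY (cell records, verbatim): «continuum YM on T⁴ ⇐ BetaPertH ∧ nine spine estimates (0/9 proved); BetaPertH ⇐ (D1) ∧ (D4) ∧
CAP+tail; G-an2-4 gates asym, D1 and NE2/3/4.»  HONEST FRAMING (cell contract, verbatim): «discharging `BetaPertH` makes Bałaban's UV stability
UNCONDITIONAL — a real constructive-QFT result; it is NOT the continuum limit and NOT the Clay problem.»  THIS MODULE DISCHARGES NOTHING of (K), of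
D1 or of the wall: [folklore] `ℓ¹`∕lattice-sum bookkeeping over ARBITRARY kernels (an2's `ExpKernelCalculus.comp ∕ tr ∕ tadpole`, leaf-03's
`PackedKernelSplit.biBubble`) with every letter a DISPLAYED `∀`-hypothesis; nothing about Bałaban's operators asserted.  No definition, no `def … : Prop`,
nothing cited, 0 sorry.  0 root-level binders of row D1 discharged (hW ∕ hR-sockets ∕ hSX-socket ∕ D1Tel ∕ D1Rep = 0); (K) NOT closed; NOT D1, NOT `BetaPertH`,
NOT continuum, NOT Clay.
ABSOLUTE RULE (cell charter, verbatim): «No internally-minted statement may enter as a cited fact. Every hypothesis is either kernel-proved in this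
package or a verbatim quotation of a PUBLISHED theorem with page reference. The manuscript(s) under audit are NOT citable for their own disputed
steps — they are the thing under adjudication; programme-internal (2001/route/tribunal) claims are never citable.»
Unit `b2b-balaban-beta-d1-formalise-leaf-04` (gen 25), D1 formalisation swarm leaf prover 04, road «BF-x» (journal [D1LEAF04-G25-INTENT-3]).
-/

noncomputable section

namespace Summit.QuantumFields.BalabanUV.Beta.D1BFx.ProfileWordFamiliesCrit



open Finset Real
open scoped BigOperators
open Literature.Probability.LatticeModels (Site)
open Literature.MathematicalPhysics.QuantumFieldTheory.Balaban1983to89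
open Literature.MathematicalPhysics.QuantumFieldTheory.Balaban1983to89.Beta
open B12Sec2to5 (l1 l1_nonneg Decay510)
open ExpKernelCalculus (MKer comp tr tadpole)
open PoissonInterior (cube mem_cube supNorm nrm supNorm_le_iff natAbs_le_supNorm supNorm_add_le supNorm_neg nrm_pos one_le_nrm supNorm_le_nrm
  mem_cube_iff_supNorm)
open Summit.QuantumFields.BalabanUV.Beta.D1BFx.PackedKernelSplit (biBubble)
open Summit.QuantumFields.BalabanUV.Beta.D1BFx.LatticeHLSRadial (sum_pow_mul_exp_scale_le)
open Summit.QuantumFields.BalabanUV.Beta.D1BFx.BlockPairRieszCount (le_supNorm_zsmul)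
open Summit.QuantumFields.BalabanUV.Beta.D1BFx.LatticeHLSProfiles (sum_pow_mul_exp_div_nrm_pow_free_scale_le summable_and_abs_tsum_le_of_abs_sum_le
  summable_and_tsum_le_of_sum_le)

open Summit.QuantumFields.BalabanUV.Beta.D1BFx.LatticeHLSRadial (sum_exp_div_nrm_pow_crit_le)
open Summit.QuantumFields.BalabanUV.Beta.D1BFx.LatticeHLSProfiles (nrm_le_nrm_of_supNorm_le)
open Summit.QuantumFields.BalabanUV.Beta.D1BFx.ProfileWordCount (exp_three_le_half abs_tr_comp_le_of_majorant abs_comp_le_of_profile_density exp_centres_le)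

variable {D : ℕ} {F : Type*} [Fintype F]

/-! ## §1 The damping-centre-free CRITICAL one-centre sum -/

omit [Fintype F] in
/-- [folklore] **DAMPING CENTRE FREE, CRITICAL POWER** `p = D` at scale `n`: for ALL centres `u, v`,
`Σ_{x∈S} e^{−(δ∕n)‖x−v‖∞}∕nrm(x−u)^D ≤ 2·(1 + 2D·3^{D−1}·(2 + 2∕δ + log n))` — on `{‖x−u‖ ≤ ‖x−v‖}` move the damping to `u`, on the complement move the
power to `v`; the kit's `sum_exp_div_nrm_pow_crit_le` at each centre. -/
theorem sum_exp_div_nrm_pow_crit_free_le (hD : 0 < D) {δ : ℝ} (hδ : 0 < δ) {n : ℕ} (hn : 1 ≤ n) (S : Finset (Site D)) (u v : Site D) :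
    ∑ x ∈ S, Real.exp (-(δ / n) * supNorm (x - v)) / nrm (x - u) ^ D ≤ 2 * (1 + 2 * D * 3 ^ (D - 1) * (2 + 2 / δ + Real.log n)) := by
  classical
  have hn0 : (0 : ℝ) < n := by exact_mod_cast hn
  rw [← Finset.sum_filter_add_sum_filter_not S (fun x => supNorm (x - u) ≤ supNorm (x - v)), two_mul]
  refine add_le_add ?_ ?_
  · calc ∑ x ∈ S.filter (fun x => supNorm (x - u) ≤ supNorm (x - v)), Real.exp (-(δ / n) * supNorm (x - v)) / nrm (x - u) ^ D
        ≤ ∑ x ∈ S.filter (fun x => supNorm (x - u) ≤ supNorm (x - v)), Real.exp (-(δ / n) * supNorm (x - u)) / nrm (x - u) ^ D := by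
          refine Finset.sum_le_sum fun x hx => ?_
          have h := (Finset.mem_filter.mp hx).2
          have := nrm_pos (x - u)
          refine div_le_div_of_nonneg_right (Real.exp_le_exp.mpr ?_) (by positivity)
          have h' : (supNorm (x - u) : ℝ) ≤ supNorm (x - v) := by exact_mod_cast h
          have hδn : 0 ≤ δ / n := by positivity
          nlinarith
      _ ≤ _ := sum_exp_div_nrm_pow_crit_le hD hδ hn _ u
  · calc ∑ x ∈ S.filter (fun x => ¬supNorm (x - u) ≤ supNorm (x - v)), Real.exp (-(δ / n) * supNorm (x - v)) / nrm (x - u) ^ D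
        ≤ ∑ x ∈ S.filter (fun x => ¬supNorm (x - u) ≤ supNorm (x - v)), Real.exp (-(δ / n) * supNorm (x - v)) / nrm (x - v) ^ D := by
          refine Finset.sum_le_sum fun x hx => ?_
          have h := not_le.mp (Finset.mem_filter.mp hx).2
          have h1 := nrm_pos (x - v)
          have h2 : nrm (x - v) ≤ nrm (x - u) := nrm_le_nrm_of_supNorm_le h.le
          exact div_le_div_of_nonneg_left (Real.exp_pos _).le (by positivity) (pow_le_pow_left₀ h1.le h2 D)
      _ ≤ _ := sum_exp_div_nrm_pow_crit_le hD hδ hn _ v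

/-! ## §2 The critical damped double count -/

omit [Fintype F] in
/-- [folklore] **THE DAMPED DOUBLE RIESZ SUM, CRITICAL POWER `p = D`** (`ε > 0`, `n ≥ 1`, all finite `S, T`, all centres `C, C′`):
`Σ_{x∈S} Σ_{z∈T} nrm(x−z)^{−D}·e^{−(ε∕n)‖x−z‖∞}·e^{−(ε∕n)‖z−C‖∞}·e^{−(ε∕n)‖x−C′‖∞} ≤ K^crit·(n^D·(2 + 4∕ε + log n))·e^{−(ε∕2n)‖C−C′‖∞}` with the n-FREE
`K^crit = 2·(1 + 2D·3^{D−1})·(1 + 2D·3^{D−1}·((D−1)!·(4∕ε)^{D−1}·(1+4∕ε)))`. -/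
theorem sum_sum_damped_riesz_crit_le (hD : 0 < D) {ε : ℝ} (hε : 0 < ε) {n : ℕ} (hn : 1 ≤ n)
    (S T : Finset (Site D)) (C C' : Site D) :
    ∑ x ∈ S, ∑ z ∈ T, 1 / nrm (x - z) ^ D * Real.exp (-(ε / n) * supNorm (x - z)) * Real.exp (-(ε / n) * supNorm (z - C))
        * Real.exp (-(ε / n) * supNorm (x - C'))
      ≤ (2 * (1 + 2 * D * 3 ^ (D - 1))) * (1 + 2 * D * 3 ^ (D - 1) * ((D - 1).factorial * (4 / ε) ^ (D - 1) * (1 + 4 / ε)))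
        * ((n : ℝ) ^ D * (2 + 4 / ε + Real.log n)) * Real.exp (-(ε / 2 / n) * supNorm (C - C')) := by
  have hn0 : (0 : ℝ) < n := by exact_mod_cast hn
  have hεn : 0 ≤ ε / n := by positivity
  have hlog : 0 ≤ Real.log n := Real.log_nonneg (by exact_mod_cast hn)
  set K₁ : ℝ := 2 * (1 + 2 * D * 3 ^ (D - 1)) with hK₁
  set K₂ : ℝ := 1 + 2 * D * 3 ^ (D - 1) * ((D - 1).factorial * (4 / ε) ^ (D - 1) * (1 + 4 / ε)) with hK₂
  set Lg : ℝ := 2 + 4 / ε + Real.log n with hLg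
  have h4ε : (0 : ℝ) ≤ 4 / ε := by positivity
  have hLg1 : 1 ≤ Lg := by rw [hLg]; linarith
  have hK₁0 : 0 ≤ K₁ := by rw [hK₁]; positivity
  have hK₂0 : 0 ≤ K₂ := by rw [hK₂]; positivity
  -- STEP 1: triangulate the centres
  have hstep : ∀ x z, 1 / nrm (x - z) ^ D * Real.exp (-(ε / n) * supNorm (x - z)) * Real.exp (-(ε / n) * supNorm (z - C))
        * Real.exp (-(ε / n) * supNorm (x - C'))
      ≤ Real.exp (-(ε / 2 / n) * supNorm (C - C')) *
        (Real.exp (-(ε / 2 / n) * supNorm (x - C')) * (Real.exp (-(ε / 2 / n) * supNorm (z - C)) / nrm (x - z) ^ D)) := by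
    intro x z
    have h := exp_three_le_half hεn x z C C'
    have hq : 0 ≤ 1 / nrm (x - z) ^ D := by have := nrm_pos (x - z); positivity
    have e1 : -(ε / n / 2) = -(ε / 2 / n) := by ring
    rw [e1] at h
    calc 1 / nrm (x - z) ^ D * Real.exp (-(ε / n) * supNorm (x - z)) * Real.exp (-(ε / n) * supNorm (z - C))
          * Real.exp (-(ε / n) * supNorm (x - C'))
        = 1 / nrm (x - z) ^ D * (Real.exp (-(ε / n) * supNorm (x - z)) * Real.exp (-(ε / n) * supNorm (z - C))
          * Real.exp (-(ε / n) * supNorm (x - C'))) := by ring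
      _ ≤ 1 / nrm (x - z) ^ D * (Real.exp (-(ε / 2 / n) * supNorm (C - C')) *
          (Real.exp (-(ε / 2 / n) * supNorm (z - C)) * Real.exp (-(ε / 2 / n) * supNorm (x - C')))) :=
          mul_le_mul_of_nonneg_left h hq
      _ = _ := by ring
  -- STEP 2: inner critical sum, damping centre free, at rate `ε∕2`
  have hinner : ∀ x, ∑ z ∈ T, Real.exp (-(ε / 2 / n) * supNorm (z - C)) / nrm (x - z) ^ D ≤ K₁ * Lg := by
    intro x
    have h := sum_exp_div_nrm_pow_crit_free_le hD (δ := ε / 2) (by positivity) hn T x C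
    have e4 : (2 : ℝ) / (ε / 2) = 4 / ε := by field_simp; ring
    rw [e4] at h
    have hre : ∑ z ∈ T, Real.exp (-(ε / 2 / n) * supNorm (z - C)) / nrm (x - z) ^ D
        = ∑ z ∈ T, Real.exp (-(ε / 2 / n) * supNorm (z - C)) / nrm (z - x) ^ D :=
      Finset.sum_congr rfl fun z _ => by rw [PoissonInterior.nrm, show x - z = -(z - x) by abel, supNorm_neg]; rfl
    rw [hre]
    refine h.trans ?_
    rw [hK₁, hLg]
    have h3 : (0 : ℝ) ≤ 2 * D * 3 ^ (D - 1) := by positivity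
    nlinarith [h3, hLg1]
  -- STEP 3: outer sum
  have houter : ∑ x ∈ S, Real.exp (-(ε / 2 / n) * supNorm (x - C')) ≤ K₂ * (n : ℝ) ^ D := by
    have h := sum_pow_mul_exp_scale_le hD (δ := ε / 2) (by positivity) hn 0 S C'
    simp only [pow_zero, one_mul, zero_add] at h
    have e4 : (2 : ℝ) / (ε / 2) = 4 / ε := by field_simp; ring
    rw [e4] at h
    have hn1 : (1 : ℝ) ≤ (n : ℝ) ^ D := one_le_pow₀ (by exact_mod_cast hn)
    calc ∑ x ∈ S, Real.exp (-(ε / 2 / n) * supNorm (x - C'))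
        ≤ 1 + 2 * D * 3 ^ (D - 1) * ((D - 1).factorial * (4 / ε) ^ (D - 1) * (1 + 4 / ε)) * (n : ℝ) ^ D := by simpa using h
      _ ≤ K₂ * (n : ℝ) ^ D := by rw [hK₂, add_mul, one_mul]; gcongr
  -- assemble
  calc ∑ x ∈ S, ∑ z ∈ T, 1 / nrm (x - z) ^ D * Real.exp (-(ε / n) * supNorm (x - z)) * Real.exp (-(ε / n) * supNorm (z - C))
          * Real.exp (-(ε / n) * supNorm (x - C'))
      ≤ ∑ x ∈ S, ∑ z ∈ T, Real.exp (-(ε / 2 / n) * supNorm (C - C')) *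
          (Real.exp (-(ε / 2 / n) * supNorm (x - C')) * (Real.exp (-(ε / 2 / n) * supNorm (z - C)) / nrm (x - z) ^ D)) :=
        Finset.sum_le_sum fun x _ => Finset.sum_le_sum fun z _ => hstep x z
    _ = Real.exp (-(ε / 2 / n) * supNorm (C - C')) *
          ∑ x ∈ S, Real.exp (-(ε / 2 / n) * supNorm (x - C')) * ∑ z ∈ T, Real.exp (-(ε / 2 / n) * supNorm (z - C)) / nrm (x - z) ^ D := by
        rw [Finset.mul_sum]; refine Finset.sum_congr rfl fun x _ => ?_; rw [Finset.mul_sum, Finset.mul_sum]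
    _ ≤ Real.exp (-(ε / 2 / n) * supNorm (C - C')) * ∑ x ∈ S, Real.exp (-(ε / 2 / n) * supNorm (x - C')) * (K₁ * Lg) := by
        gcongr with x _
        exact hinner x
    _ = Real.exp (-(ε / 2 / n) * supNorm (C - C')) * (K₁ * Lg) * ∑ x ∈ S, Real.exp (-(ε / 2 / n) * supNorm (x - C')) := by
        rw [← Finset.sum_mul]; ring
    _ ≤ Real.exp (-(ε / 2 / n) * supNorm (C - C')) * (K₁ * Lg) * (K₂ * (n : ℝ) ^ D) := by
        gcongr
    _ = K₁ * K₂ * ((n : ℝ) ^ D * Lg) * Real.exp (-(ε / 2 / n) * supNorm (C - C')) := by ring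

/-! ## §3 The critical bubble word and its family -/

section Words

variable (hD : 0 < D) {n : ℕ} (hn : 1 ≤ n)
  {L₁ L₂ : MKer D F} {κ₁ κ₂ A A' δ σ : ℝ} {a b r : ℕ}
  (hκ₁ : 0 ≤ κ₁) (hκ₂ : 0 ≤ κ₂) (hA : 0 ≤ A) (hA' : 0 ≤ A') (hδ : 0 < δ) (hσ : 0 < σ) (hab : a + b = D)
  (hL₁ : ∀ x y g g', |L₁ x y g g'| ≤ κ₁ / nrm (x - y) ^ a * Real.exp (-(δ / n) * supNorm (x - y)))
  (hL₂ : ∀ x y g g', |L₂ x y g g'| ≤ κ₂ / nrm (x - y) ^ b * Real.exp (-(δ / n) * supNorm (x - y)))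
include hD hn hκ₁ hκ₂ hA hA' hδ hσ hab hL₁ hL₂

/-- [folklore] **THE CRITICAL TWO-LEG BUBBLE, EXPLICIT CENTRES** (`a + b = D`): `|biBubble L₁ V L₂ V′| ≤ |F|²·(Kᵣ(a)κ₁A)·(Kᵣ(b)κ₂A′)·K^crit(ε)·(n^D·(2 + 4∕ε + log n))·
e^{−(ε∕2n)‖C−C′‖∞}`, `ε = min σ (2δ)`. -/
theorem abs_biBubble_le_of_profiles_crit {V V' : MKer D F} {C C' : Site D}
    (hVb : ∀ y z g f, |V y z g f| ≤ A * Real.exp (-(σ / n) * supNorm (z - C)))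
    (hVr : ∀ y z g f, r < supNorm (y - z) → V y z g f = 0)
    (hV'b : ∀ y z g f, |V' y z g f| ≤ A' * Real.exp (-(σ / n) * supNorm (z - C')))
    (hV'r : ∀ y z g f, r < supNorm (y - z) → V' y z g f = 0) :
    |biBubble L₁ V L₂ V'| ≤ (Fintype.card F : ℝ) ^ 2 *
      (((Fintype.card F : ℝ) * (2 * r + 1) ^ D * ((r : ℝ) + 1) ^ a * Real.exp (δ * r) * κ₁ * A)
        * ((Fintype.card F : ℝ) * (2 * r + 1) ^ D * ((r : ℝ) + 1) ^ b * Real.exp (δ * r) * κ₂ * A')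
        * ((2 * (1 + 2 * D * 3 ^ (D - 1))) * (1 + 2 * D * 3 ^ (D - 1) * ((D - 1).factorial * (4 / min σ (2 * δ)) ^ (D - 1) * (1 + 4 / min σ (2 * δ))))
          * ((n : ℝ) ^ D * (2 + 4 / min σ (2 * δ) + Real.log n)) * Real.exp (-(min σ (2 * δ) / 2 / n) * supNorm (C - C')))) := by
  have hn0 : (0 : ℝ) < n := by exact_mod_cast hn
  set ε : ℝ := min σ (2 * δ) with hε
  have hε0 : 0 < ε := lt_min hσ (by linarith)
  have hεσ : ε ≤ σ := min_le_left _ _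
  have hεδ : ε ≤ 2 * δ := min_le_right _ _
  set K₁ : ℝ := (Fintype.card F : ℝ) * (2 * r + 1) ^ D * ((r : ℝ) + 1) ^ a * Real.exp (δ * r) * κ₁ * A with hK₁
  set K₂ : ℝ := (Fintype.card F : ℝ) * (2 * r + 1) ^ D * ((r : ℝ) + 1) ^ b * Real.exp (δ * r) * κ₂ * A' with hK₂
  have hK₁0 : 0 ≤ K₁ := by rw [hK₁]; positivity
  have hK₂0 : 0 ≤ K₂ := by rw [hK₂]; positivity
  have hM₁ := abs_comp_le_of_profile_density hn hκ₁ hA hδ.le hL₁ hVb hVr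
  have hM₂ := abs_comp_le_of_profile_density hn hκ₂ hA' hδ.le hL₂ hV'b hV'r
  unfold PackedKernelSplit.biBubble
  refine le_trans (abs_tr_comp_le_of_majorant
    (M₁ := fun x z => K₁ * (1 / nrm (x - z) ^ a * Real.exp (-(δ / n) * supNorm (x - z)) * Real.exp (-(σ / n) * supNorm (z - C))))
    (M₂ := fun z x => K₂ * (1 / nrm (z - x) ^ b * Real.exp (-(δ / n) * supNorm (z - x)) * Real.exp (-(σ / n) * supNorm (x - C'))))
    (fun x z g f => by simpa only [hK₁] using hM₁ x z g f) (fun z x f g => by simpa only [hK₂] using hM₂ z x f g)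
    (fun x z => by have := nrm_pos (x - z); positivity) (fun z x => by have := nrm_pos (z - x); positivity) fun S T => ?_) (le_of_eq (by rw [hK₁, hK₂, hε]))
  have hcore := sum_sum_damped_riesz_crit_le hD hε0 hn S T C C'
  have hpt : ∀ x z, K₁ * (1 / nrm (x - z) ^ a * Real.exp (-(δ / n) * supNorm (x - z)) * Real.exp (-(σ / n) * supNorm (z - C)))
        * (K₂ * (1 / nrm (z - x) ^ b * Real.exp (-(δ / n) * supNorm (z - x)) * Real.exp (-(σ / n) * supNorm (x - C'))))
      ≤ K₁ * K₂ * (1 / nrm (x - z) ^ D * Real.exp (-(ε / n) * supNorm (x - z)) * Real.exp (-(ε / n) * supNorm (z - C))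
        * Real.exp (-(ε / n) * supNorm (x - C'))) := by
    intro x z
    have hzx : nrm (z - x) = nrm (x - z) := by rw [show z - x = -(x - z) by abel, PoissonInterior.nrm_neg]
    have hzx' : supNorm (z - x) = supNorm (x - z) := by rw [show z - x = -(x - z) by abel, supNorm_neg]
    rw [hzx, hzx']
    have hq := nrm_pos (x - z)
    have t0 : (0 : ℝ) ≤ supNorm (x - z) := Nat.cast_nonneg _
    have t1 : (0 : ℝ) ≤ supNorm (z - C) := Nat.cast_nonneg _
    have t2 : (0 : ℝ) ≤ supNorm (x - C') := Nat.cast_nonneg _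
    have e1 : Real.exp (-(δ / n) * supNorm (x - z)) * Real.exp (-(δ / n) * supNorm (x - z)) ≤ Real.exp (-(ε / n) * supNorm (x - z)) := by
      rw [← Real.exp_add]; apply Real.exp_le_exp.mpr
      have h' : ε / n * (supNorm (x - z) : ℝ) ≤ 2 * δ / n * (supNorm (x - z) : ℝ) :=
        mul_le_mul_of_nonneg_right (div_le_div_of_nonneg_right hεδ hn0.le) t0
      have e' : 2 * δ / (n : ℝ) * (supNorm (x - z) : ℝ) = δ / n * supNorm (x - z) + δ / n * supNorm (x - z) := by ring
      linarith
    have e2 : Real.exp (-(σ / n) * supNorm (z - C)) ≤ Real.exp (-(ε / n) * supNorm (z - C)) := by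
      apply Real.exp_le_exp.mpr
      have h' : ε / n * (supNorm (z - C) : ℝ) ≤ σ / n * (supNorm (z - C) : ℝ) :=
        mul_le_mul_of_nonneg_right (div_le_div_of_nonneg_right hεσ hn0.le) t1
      linarith
    have e3 : Real.exp (-(σ / n) * supNorm (x - C')) ≤ Real.exp (-(ε / n) * supNorm (x - C')) := by
      apply Real.exp_le_exp.mpr
      have h' : ε / n * (supNorm (x - C') : ℝ) ≤ σ / n * (supNorm (x - C') : ℝ) :=
        mul_le_mul_of_nonneg_right (div_le_div_of_nonneg_right hεσ hn0.le) t2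
      linarith
    have epow : 1 / nrm (x - z) ^ a * (1 / nrm (x - z) ^ b) = 1 / nrm (x - z) ^ D := by
      have hD' : nrm (x - z) ^ D = nrm (x - z) ^ a * nrm (x - z) ^ b := by rw [← pow_add, hab]
      rw [hD']; field_simp
    calc K₁ * (1 / nrm (x - z) ^ a * Real.exp (-(δ / n) * supNorm (x - z)) * Real.exp (-(σ / n) * supNorm (z - C)))
          * (K₂ * (1 / nrm (x - z) ^ b * Real.exp (-(δ / n) * supNorm (x - z)) * Real.exp (-(σ / n) * supNorm (x - C'))))
        = K₁ * K₂ * ((1 / nrm (x - z) ^ a * (1 / nrm (x - z) ^ b)) * (Real.exp (-(δ / n) * supNorm (x - z)) * Real.exp (-(δ / n) * supNorm (x - z)))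
          * Real.exp (-(σ / n) * supNorm (z - C)) * Real.exp (-(σ / n) * supNorm (x - C'))) := by ring
      _ ≤ K₁ * K₂ * ((1 / nrm (x - z) ^ D) * Real.exp (-(ε / n) * supNorm (x - z))
          * Real.exp (-(ε / n) * supNorm (z - C)) * Real.exp (-(ε / n) * supNorm (x - C'))) := by
          rw [epow]; gcongr
  calc ∑ x ∈ S, ∑ z ∈ T, K₁ * (1 / nrm (x - z) ^ a * Real.exp (-(δ / n) * supNorm (x - z)) * Real.exp (-(σ / n) * supNorm (z - C)))
          * (K₂ * (1 / nrm (z - x) ^ b * Real.exp (-(δ / n) * supNorm (z - x)) * Real.exp (-(σ / n) * supNorm (x - C'))))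
      ≤ ∑ x ∈ S, ∑ z ∈ T, K₁ * K₂ * (1 / nrm (x - z) ^ D * Real.exp (-(ε / n) * supNorm (x - z)) * Real.exp (-(ε / n) * supNorm (z - C))
          * Real.exp (-(ε / n) * supNorm (x - C'))) := Finset.sum_le_sum fun x _ => Finset.sum_le_sum fun z _ => hpt x z
    _ = K₁ * K₂ * ∑ x ∈ S, ∑ z ∈ T, 1 / nrm (x - z) ^ D * Real.exp (-(ε / n) * supNorm (x - z)) * Real.exp (-(ε / n) * supNorm (z - C))
          * Real.exp (-(ε / n) * supNorm (x - C')) := by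
        rw [Finset.mul_sum]; refine Finset.sum_congr rfl fun x _ => ?_; rw [Finset.mul_sum]
    _ ≤ K₁ * K₂ * _ := mul_le_mul_of_nonneg_left hcore (mul_nonneg hK₁0 hK₂0)
    _ = _ := by ring

/-- [folklore] **THE CRITICAL PROFILE WORD-FAMILY LETTER (d1-b)** (`a + b = D`): `Decay510 (z ↦ biBubble L₁ (𝒱 μ 0) L₂ (𝒱′ ν z))
(|F|²·(Kᵣ(a)κ₁A)·(Kᵣ(b)κ₂A′)·K^crit(ε)·(n^D·(2 + 4∕ε + log n))) (ε∕(2D))`, `ε = min σ (2δ)` — the MAIN word's `n^{−8}(c + log n)` shape at `D = 4`,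
`a = b = 2`, `κ₁κ₂ ≍ n⁻⁴`, `A = A′ ≍ n⁻⁴` (no coefficient claimed). -/
theorem decay510_biBubble_of_profiles_crit
    {𝒱 𝒱' : Fin D → Site D → MKer D F} (μ ν : Fin D)
    (hVb : ∀ y p q g f, |𝒱 μ y p q g f| ≤ A * Real.exp (-(σ / n) * supNorm (q - (n : ℤ) • y)))
    (hVr : ∀ y p q g f, r < supNorm (p - q) → 𝒱 μ y p q g f = 0)
    (hV'b : ∀ y p q g f, |𝒱' ν y p q g f| ≤ A' * Real.exp (-(σ / n) * supNorm (q - (n : ℤ) • y)))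
    (hV'r : ∀ y p q g f, r < supNorm (p - q) → 𝒱' ν y p q g f = 0) :
    Decay510 (fun z => biBubble L₁ (𝒱 μ 0) L₂ (𝒱' ν z))
      ((Fintype.card F : ℝ) ^ 2 *
        (((Fintype.card F : ℝ) * (2 * r + 1) ^ D * ((r : ℝ) + 1) ^ a * Real.exp (δ * r) * κ₁ * A)
          * ((Fintype.card F : ℝ) * (2 * r + 1) ^ D * ((r : ℝ) + 1) ^ b * Real.exp (δ * r) * κ₂ * A')
          * ((2 * (1 + 2 * D * 3 ^ (D - 1))) * (1 + 2 * D * 3 ^ (D - 1) * ((D - 1).factorial * (4 / min σ (2 * δ)) ^ (D - 1) * (1 + 4 / min σ (2 * δ))))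
            * ((n : ℝ) ^ D * (2 + 4 / min σ (2 * δ) + Real.log n)))))
      (min σ (2 * δ) / 2 / D) := by
  intro z
  have h := abs_biBubble_le_of_profiles_crit hD hn hκ₁ hκ₂ hA hA' hδ hσ hab hL₁ hL₂ (hVb 0) (hVr 0) (hV'b z) (hV'r z)
  refine h.trans ?_
  have hmin : 0 < min σ (2 * δ) := lt_min hσ (by linarith)
  have hε0 : 0 ≤ min σ (2 * δ) / 2 := by linarith
  have hc := exp_centres_le hD hn hε0 z
  have hlog : 0 ≤ Real.log n := Real.log_nonneg (by exact_mod_cast hn)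
  have hK : 0 ≤ (Fintype.card F : ℝ) ^ 2 *
        (((Fintype.card F : ℝ) * (2 * r + 1) ^ D * ((r : ℝ) + 1) ^ a * Real.exp (δ * r) * κ₁ * A)
          * ((Fintype.card F : ℝ) * (2 * r + 1) ^ D * ((r : ℝ) + 1) ^ b * Real.exp (δ * r) * κ₂ * A')
          * ((2 * (1 + 2 * D * 3 ^ (D - 1))) * (1 + 2 * D * 3 ^ (D - 1) * ((D - 1).factorial * (4 / min σ (2 * δ)) ^ (D - 1) * (1 + 4 / min σ (2 * δ))))
            * ((n : ℝ) ^ D * (2 + 4 / min σ (2 * δ) + Real.log n)))) := by positivity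
  calc _ = (Fintype.card F : ℝ) ^ 2 *
        (((Fintype.card F : ℝ) * (2 * r + 1) ^ D * ((r : ℝ) + 1) ^ a * Real.exp (δ * r) * κ₁ * A)
          * ((Fintype.card F : ℝ) * (2 * r + 1) ^ D * ((r : ℝ) + 1) ^ b * Real.exp (δ * r) * κ₂ * A')
          * ((2 * (1 + 2 * D * 3 ^ (D - 1))) * (1 + 2 * D * 3 ^ (D - 1) * ((D - 1).factorial * (4 / min σ (2 * δ)) ^ (D - 1) * (1 + 4 / min σ (2 * δ))))
            * ((n : ℝ) ^ D * (2 + 4 / min σ (2 * δ) + Real.log n)))) * Real.exp (-(min σ (2 * δ) / 2 / n) * supNorm ((n : ℤ) • (0 : Site D) - (n : ℤ) • z)) := by ring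
    _ ≤ _ := mul_le_mul_of_nonneg_left hc hK

end Words

end Summit.QuantumFields.BalabanUV.Beta.D1BFx.ProfileWordFamiliesCrit

end
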